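import Literature.Analysis.TotalPositivity.PolyaFrequencyProductEstimates
import Literature.Analysis.Fourier.SmoothWindowKernel
import Mathlib.Analysis.Fourier.Inversion
import Mathlib.Analysis.SpecialFunctions.ImproperIntegrals
import Mathlib.MeasureTheory.Integral.DominatedConvergence
import Mathlib.Topology.Instances.Matrix
import HarnessLib

/-!
# Pólya frequency functions: the passage to infinitely many exponential factors
(Schoenberg 1951, sufficiency half, general case)

Trunk `Literature/Analysis/TotalPositivity`, sixth proofs file accompanying
`PolyaFrequencyFunctions.lean` (the named fact `schoenberg1951_pf_laplace`).  Abstract limit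
theorem: suppose that for every `N` we are given a CONTINUOUS Pólya frequency function `Λ_N` whose
bilateral Laplace transform converges absolutely on `|Re s| < ρ` to
`1/Ψ_N(s)`, `Ψ_N(s) = e^{−(γ+ε_N)s²} ∏_{ν<N} (1 + d_ν s)e^{−d_ν s}` (`γ ≥ 0`, `0 ≤ ε_N ≤ 1`,
`ε_N → 0`, `Σ d_ν² < ∞`, `ρ|d_ν| ≤ 1`, and at least two `d_ν ≠ 0`) — such `Λ_N` are produced in
`PolyaFrequencyFiniteProduct.lean` by convolving a Gaussian with one-sided exponentials.  Then
there is a Pólya frequency function `Λ` with reciprocal transform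
`Ψ(s) = e^{−γs²} ∏' (1 + d_ν s)e^{−d_ν s}` on the same strip (`exists_pf_of_approx`).

The proof avoids analytic continuation: (1) by Fourier inversion (Mathlib), each tilted function
`e^{−cx}Λ_N(x)` (`|c| < ρ`) is the inverse Fourier transform of `w ↦ 1/Ψ_N(c + 2πiw)`, which by
the product estimates (`norm_prod_range_linExp_ge`) is dominated by an integrable
`K/(1 + βw²)` uniformly in `N`; hence `e^{−cx}Λ_N(x) ≤ S_c` uniformly (`tilt_le`);
(2) at `c = 0`, dominated convergence on the Fourier side gives the pointwise limit
`Λ(x) = lim Λ_N(x)` (`tendsto_approx`); (3) the two-sided exponential bounds make dominated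
convergence applicable to `∫ e^{−xs}Λ_N(x)dx = 1/Ψ_N(s) → 1/Ψ(s)`, giving the transform of `Λ`,
its integrability and `∫Λ = 1 > 0`; total positivity and non-negativity pass to pointwise limits.

## References

* I. J. Schoenberg, *On Pólya frequency functions. I*, J. Analyse Math. 1 (1951) 331–374, §§2–4
  (Thm. 1, sufficiency: the limit of the finite convolutions). [Schoenberg1951]
* I. I. Hirschman, D. V. Widder, *The Convolution Transform*, Princeton 1955, Ch. III
  (the non-finite kernels as inverse bilateral Laplace transforms of `1/E(s)`). [folklore]
-/

noncomputable section

open MeasureTheory Set Filter Complex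
open scoped Topology FourierTransform RealInnerProductSpace

namespace Literature.Analysis.TotalPositivity

/-! ### The Fourier transform of a tilted function

(`‖𝓕⁻ f x‖ ≤ ∫ ‖f‖` is `Literature.Analysis.Fourier.norm_fourierInv_le_integral_norm`,
SmoothWindowKernel.lean.) -/

/-- **The Fourier transform of a tilted function is the Laplace transform on a vertical line**:
if the bilateral Laplace transform of `Λ` converges absolutely on `|Re s| < ρ` to `1/Ψ`, then for
`|c| < ρ` the function `x ↦ e^{−cx}Λ(x)` is integrable and
`𝓕(e^{−c·}Λ)(w) = 1/Ψ(c + 2πiw)`. [folklore] -/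
theorem fourier_tilt_eq {Λ : ℝ → ℝ} {Ψ : ℂ → ℂ} {ρ c : ℝ} (h : HasLaplaceTransformInvOn Λ Ψ (-ρ) ρ)
    (hc : |c| < ρ) :
    Integrable (fun x : ℝ => ((Real.exp (-(c * x)) * Λ x : ℝ) : ℂ)) ∧
      ∀ w : ℝ, 𝓕 (fun x : ℝ => ((Real.exp (-(c * x)) * Λ x : ℝ) : ℂ)) w =
        1 / Ψ ((c : ℂ) + 2 * Real.pi * w * Complex.I) := by
  have hc' : -ρ < c ∧ c < ρ := abs_lt.1 hc
  constructor
  · obtain ⟨hint, -, -⟩ := h (c : ℂ) (by simpa using hc'.1) (by simpa using hc'.2)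
    refine hint.congr (Eventually.of_forall fun x => ?_)
    push_cast
    ring_nf
  · intro w
    set s : ℂ := (c : ℂ) + 2 * Real.pi * w * Complex.I with hs_def
    have hs : s.re = c := by simp [hs_def]
    obtain ⟨-, -, heq⟩ := h s (by rw [hs]; exact hc'.1) (by rw [hs]; exact hc'.2)
    rw [Real.fourier_real_eq_integral_exp_smul, ← heq]
    congr 1
    funext v
    rw [smul_eq_mul]
    push_cast
    rw [← mul_assoc, ← Complex.exp_add]
    congr 2
    rw [hs_def]
    ring

/-! ### The abstract limit theorem -/

section Approx

variable {γ : ℝ} {d : ℕ → ℝ} {ρ : ℝ} {ν₁ ν₂ : ℕ}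

/-- The finite reciprocal transforms `Ψ_N(s) = e^{−gs²} ∏_{ν<N} (1 + d_ν s)e^{−d_ν s}` are
continuous. [folklore] -/
theorem continuous_expProd (g : ℝ) (d : ℕ → ℝ) (N : ℕ) :
    Continuous fun s : ℂ => Complex.exp (-(g : ℂ) * s ^ 2) *
      ∏ ν ∈ Finset.range N, ((1 + (d ν : ℂ) * s) * Complex.exp (-((d ν : ℂ) * s))) :=
  (by fun_prop : Continuous fun s : ℂ => Complex.exp (-(g : ℂ) * s ^ 2)).mul
    (continuous_finsetProd _ fun ν _ => by fun_prop)

/-- **The key estimate on vertical lines**: for `g ≥ 0`, `|Re s| < ρ`, and `N > ν₁, ν₂`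
(two indices with `d ≠ 0`),
`‖1/(e^{−gs²} ∏_{ν<N} (1 + d_ν s)e^{−d_ν s})‖ ≤ e^{gρ²} / (P(Re s) (1 + β(Re s) (Im s)²))`,
`P(c) = ∏' (1 + d_ν c)e^{−d_ν c} > 0`, `β(c) = |d_{ν₁}d_{ν₂}/((1 + d_{ν₁}c)(1 + d_{ν₂}c))|`.
[cite: Schoenberg1951, §3] [folklore] -/
theorem norm_inv_expProd_le (hd : Summable fun ν => d ν ^ 2) (hρd : ∀ ν, ρ * |d ν| ≤ 1)
    (hne : ν₁ ≠ ν₂) {g : ℝ} (hg : 0 ≤ g) {s : ℂ} (hs : |s.re| < ρ) {N : ℕ} (h1 : ν₁ < N)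
    (h2 : ν₂ < N) :
    ‖1 / (Complex.exp (-(g : ℂ) * s ^ 2) *
        ∏ ν ∈ Finset.range N, ((1 + (d ν : ℂ) * s) * Complex.exp (-((d ν : ℂ) * s))))‖ ≤
      Real.exp (g * ρ ^ 2) /
        ((∏' ν, (1 + d ν * s.re) * Real.exp (-(d ν * s.re))) *
          (1 + |d ν₁ / (1 + d ν₁ * s.re) * (d ν₂ / (1 + d ν₂ * s.re))| * s.im ^ 2)) := by
  obtain ⟨hP0, -⟩ := tprod_le_prod_range_linExp_real hd hρd hs N
  have hlow := norm_prod_range_linExp_ge hd hρd hs hne h1 h2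
  set P := ∏' ν, (1 + d ν * s.re) * Real.exp (-(d ν * s.re)) with hP
  set B := 1 + |d ν₁ / (1 + d ν₁ * s.re) * (d ν₂ / (1 + d ν₂ * s.re))| * s.im ^ 2 with hB
  have hB1 : 1 ≤ B := by
    rw [hB]
    nlinarith [abs_nonneg (d ν₁ / (1 + d ν₁ * s.re) * (d ν₂ / (1 + d ν₂ * s.re))),
      sq_nonneg s.im]
  have hPB : 0 < P * B := mul_pos hP0 (by linarith)
  rw [norm_div, norm_one, norm_mul, Complex.norm_exp]
  have hre : (-(g : ℂ) * s ^ 2).re = -(g * (s.re ^ 2 - s.im ^ 2)) := by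
    simp [Complex.mul_re, sq, Complex.mul_im]
  rw [hre]
  have hexp : Real.exp (-(g * ρ ^ 2)) ≤ Real.exp (-(g * (s.re ^ 2 - s.im ^ 2))) := by
    rw [Real.exp_le_exp]
    have h3 : s.re ^ 2 < ρ ^ 2 := by
      have := abs_lt.1 hs
      nlinarith [abs_nonneg s.re, sq_abs s.re]
    nlinarith [sq_nonneg s.im]
  have hden : Real.exp (-(g * ρ ^ 2)) * (P * B) ≤ Real.exp (-(g * (s.re ^ 2 - s.im ^ 2))) *
      ‖∏ ν ∈ Finset.range N, ((1 + (d ν : ℂ) * s) * Complex.exp (-((d ν : ℂ) * s)))‖ :=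
    mul_le_mul hexp hlow hPB.le (Real.exp_pos _).le
  have hpos : 0 < Real.exp (-(g * ρ ^ 2)) * (P * B) := mul_pos (Real.exp_pos _) hPB
  rw [div_le_div_iff₀ (lt_of_lt_of_le hpos hden) hPB, one_mul]
  calc P * B = Real.exp (g * ρ ^ 2) * (Real.exp (-(g * ρ ^ 2)) * (P * B)) := by
        rw [← mul_assoc, ← Real.exp_add, add_neg_cancel, Real.exp_zero, one_mul]
    _ ≤ _ := mul_le_mul_of_nonneg_left hden (Real.exp_pos _).le

/-- The majorant `w ↦ M/(P (1 + β (2πw)²))` is integrable for `β > 0`. [folklore] -/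
theorem integrable_majorant (M P : ℝ) {β : ℝ} (hβ : 0 < β) :
    Integrable fun w : ℝ => M / (P * (1 + β * (2 * Real.pi * w) ^ 2)) := by
  have hk : Real.sqrt β * (2 * Real.pi) ≠ 0 :=
    mul_ne_zero (Real.sqrt_pos.2 hβ).ne' (by positivity)
  have h := (integrable_inv_one_add_sq.comp_mul_left' hk).const_mul (M / P)
  refine h.congr (Eventually.of_forall fun w => ?_)
  simp only
  rw [mul_pow, mul_pow, Real.sq_sqrt hβ.le]
  field_simp

variable (hγ : 0 ≤ γ) (hd : Summable fun ν => d ν ^ 2) (hρ : 0 < ρ) (hρd : ∀ ν, ρ * |d ν| ≤ 1)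
  (hne : ν₁ ≠ ν₂) (hd1 : d ν₁ ≠ 0) (hd2 : d ν₂ ≠ 0)
  {ε : ℕ → ℝ} (hε0 : ∀ N, 0 ≤ ε N) (hε1 : ∀ N, ε N ≤ 1)
  {Λs : ℕ → ℝ → ℝ} (hPF : ∀ N, IsPolyaFrequencyFun (Λs N)) (hcont : ∀ N, Continuous (Λs N))
  (hLap : ∀ N, HasLaplaceTransformInvOn (Λs N)
    (fun s => Complex.exp (-((γ + ε N : ℝ) : ℂ) * s ^ 2) *
      ∏ ν ∈ Finset.range N, ((1 + (d ν : ℂ) * s) * Complex.exp (-((d ν : ℂ) * s)))) (-ρ) ρ)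

include hρd hd1 hd2 in
/-- The coefficient `β(c) > 0` for `|c| < ρ`. [folklore] -/
theorem beta_pos {c : ℝ} (hc : |c| < ρ) :
    0 < |d ν₁ / (1 + d ν₁ * c) * (d ν₂ / (1 + d ν₂ * c))| := by
  have h1 := one_add_mul_pos_of_abs_lt (hρd ν₁) hc
  have h2 := one_add_mul_pos_of_abs_lt (hρd ν₂) hc
  exact abs_pos.2 (mul_ne_zero (div_ne_zero hd1 h1.ne') (div_ne_zero hd2 h2.ne'))

include hγ hd hρd hne hd1 hd2 hε0 hε1 hcont hLap in
/-- **The tilted approximants and their Fourier transforms.**  For `|c| < ρ` and `N > ν₁, ν₂`,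
`G(x) = e^{−cx}Λ_N(x)` is continuous and integrable, `𝓕G(w) = 1/Ψ_N(c + 2πiw)` is continuous,
dominated by the integrable `w ↦ e^{(γ+1)ρ²}/(P(c)(1 + β(c)(2πw)²))` (independent of `N`), hence
integrable, and Fourier inversion holds: `𝓕⁻(𝓕 G) = G`. [cite: Schoenberg1951, §4] [folklore] -/
theorem tilt_package {c : ℝ} (hc : |c| < ρ) {N : ℕ} (hN1 : ν₁ < N) (hN2 : ν₂ < N) :
    Continuous (fun x : ℝ => ((Real.exp (-(c * x)) * Λs N x : ℝ) : ℂ)) ∧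
    Integrable (fun x : ℝ => ((Real.exp (-(c * x)) * Λs N x : ℝ) : ℂ)) ∧
    (𝓕 (fun x : ℝ => ((Real.exp (-(c * x)) * Λs N x : ℝ) : ℂ)) = fun w : ℝ =>
      1 / (Complex.exp (-((γ + ε N : ℝ) : ℂ) * ((c : ℂ) + 2 * Real.pi * w * Complex.I) ^ 2) *
        ∏ ν ∈ Finset.range N, ((1 + (d ν : ℂ) * ((c : ℂ) + 2 * Real.pi * w * Complex.I)) *
          Complex.exp (-((d ν : ℂ) * ((c : ℂ) + 2 * Real.pi * w * Complex.I)))))) ∧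
    Continuous (𝓕 (fun x : ℝ => ((Real.exp (-(c * x)) * Λs N x : ℝ) : ℂ))) ∧
    (∀ w : ℝ, ‖𝓕 (fun x : ℝ => ((Real.exp (-(c * x)) * Λs N x : ℝ) : ℂ)) w‖ ≤
      Real.exp ((γ + 1) * ρ ^ 2) / ((∏' ν, (1 + d ν * c) * Real.exp (-(d ν * c))) *
        (1 + |d ν₁ / (1 + d ν₁ * c) * (d ν₂ / (1 + d ν₂ * c))| * (2 * Real.pi * w) ^ 2))) ∧
    Integrable (𝓕 (fun x : ℝ => ((Real.exp (-(c * x)) * Λs N x : ℝ) : ℂ))) ∧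
    𝓕⁻ (𝓕 (fun x : ℝ => ((Real.exp (-(c * x)) * Λs N x : ℝ) : ℂ))) =
      fun x : ℝ => ((Real.exp (-(c * x)) * Λs N x : ℝ) : ℂ) := by
  set P := ∏' ν, (1 + d ν * c) * Real.exp (-(d ν * c)) with hP
  set β := |d ν₁ / (1 + d ν₁ * c) * (d ν₂ / (1 + d ν₂ * c))| with hβ
  have hβ0 : 0 < β := beta_pos hρd hd1 hd2 hc
  set maj : ℝ → ℝ := fun w => Real.exp ((γ + 1) * ρ ^ 2) / (P * (1 + β * (2 * Real.pi * w) ^ 2))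
    with hmaj
  have hmaji : Integrable maj := integrable_majorant _ _ hβ0
  set G : ℝ → ℂ := fun x => ((Real.exp (-(c * x)) * Λs N x : ℝ) : ℂ) with hG
  obtain ⟨hGi, hGF⟩ := fourier_tilt_eq (hLap N) hc
  have hGc : Continuous G := by
    rw [hG]
    fun_prop
  have hFeq : 𝓕 G = fun w : ℝ => 1 / (Complex.exp (-((γ + ε N : ℝ) : ℂ) *
      ((c : ℂ) + 2 * Real.pi * w * Complex.I) ^ 2) *
        ∏ ν ∈ Finset.range N, ((1 + (d ν : ℂ) * ((c : ℂ) + 2 * Real.pi * w * Complex.I)) *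
          Complex.exp (-((d ν : ℂ) * ((c : ℂ) + 2 * Real.pi * w * Complex.I))))) :=
    funext hGF
  have hFle : ∀ w : ℝ, ‖𝓕 G w‖ ≤ maj w := by
    intro w
    rw [hFeq]
    have hs : |((c : ℂ) + 2 * Real.pi * w * Complex.I).re| < ρ := by simpa using hc
    have h := norm_inv_expProd_le hd hρd hne (g := γ + ε N) (by linarith [hε0 N]) hs hN1 hN2
    have hre : ((c : ℂ) + 2 * Real.pi * w * Complex.I).re = c := by simp
    have him : ((c : ℂ) + 2 * Real.pi * w * Complex.I).im = 2 * Real.pi * w := by simp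
    rw [hre, him] at h
    refine h.trans ?_
    rw [hmaj]
    have hPB : 0 < P * (1 + β * (2 * Real.pi * w) ^ 2) := by
      obtain ⟨hP0, -⟩ := tprod_le_prod_range_linExp_real hd hρd hc 0
      positivity
    refine div_le_div_of_nonneg_right ?_ hPB.le
    exact Real.exp_le_exp.2 (mul_le_mul_of_nonneg_right (by linarith [hε1 N]) (sq_nonneg ρ))
  have hFc : Continuous (𝓕 G) := by
    rw [hFeq]
    refine Continuous.div continuous_const ((continuous_expProd (γ + ε N) d N).comp
      (by fun_prop)) fun w => ?_
    have hs : |((c : ℂ) + 2 * Real.pi * w * Complex.I).re| < ρ := by simpa using hc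
    refine mul_ne_zero (Complex.exp_ne_zero _) (Finset.prod_ne_zero_iff.2 fun ν _ => ?_)
    exact mul_ne_zero (one_add_mul_ne_zero_of_abs_re_lt (hρd ν) hs) (Complex.exp_ne_zero _)
  have hFi : Integrable (𝓕 G) :=
    hmaji.mono' hFc.aestronglyMeasurable (Eventually.of_forall hFle)
  exact ⟨hGc, hGi, hFeq, hFc, hFle, hFi, hGc.fourierInv_fourier_eq hGi hFi⟩

include hγ hd hρd hne hd1 hd2 hε0 hε1 hPF hcont hLap in
/-- **Uniform two-sided exponential bounds**: for `|c| < ρ` there is `S` with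
`e^{−cx} Λ_N(x) ≤ S` for all `x` and all `N > ν₁, ν₂` — Fourier inversion for the continuous
integrable function `e^{−c·}Λ_N`, whose Fourier transform `1/Ψ_N(c + 2πi·)` is dominated by an
integrable function independent of `N`. [cite: Schoenberg1951, §4] [folklore] -/
theorem tilt_le {c : ℝ} (hc : |c| < ρ) :
    ∃ S : ℝ, ∀ N, ν₁ < N → ν₂ < N → ∀ x, Real.exp (-(c * x)) * Λs N x ≤ S := by
  set maj : ℝ → ℝ := fun w => Real.exp ((γ + 1) * ρ ^ 2) /
    ((∏' ν, (1 + d ν * c) * Real.exp (-(d ν * c))) *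
      (1 + |d ν₁ / (1 + d ν₁ * c) * (d ν₂ / (1 + d ν₂ * c))| * (2 * Real.pi * w) ^ 2)) with hmaj
  have hmaji : Integrable maj := integrable_majorant _ _ (beta_pos hρd hd1 hd2 hc)
  refine ⟨∫ w, maj w, fun N hN1 hN2 x => ?_⟩
  obtain ⟨-, -, -, -, hFle, hFi, hinv⟩ :=
    tilt_package hγ hd hρd hne hd1 hd2 hε0 hε1 hcont hLap hc hN1 hN2
  have hinvx := congrFun hinv x
  have hle : ‖((Real.exp (-(c * x)) * Λs N x : ℝ) : ℂ)‖ ≤ ∫ w, maj w := by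
    rw [← hinvx]
    exact (Literature.Analysis.Fourier.norm_fourierInv_le_integral_norm _ _).trans (integral_mono hFi.norm hmaji hFle)
  have hGx : ‖((Real.exp (-(c * x)) * Λs N x : ℝ) : ℂ)‖ = Real.exp (-(c * x)) * Λs N x := by
    simp only [Complex.norm_real, Real.norm_eq_abs]
    exact abs_of_nonneg (mul_nonneg (Real.exp_pos _).le ((hPF N).nonneg x))
  rwa [hGx] at hle

include hd hρd in
/-- **Convergence of the reciprocal transforms**: for `|Re s| < ρ`,
`1/Ψ_N(s) → 1/Ψ(s)`, `Ψ(s) = e^{−γs²} ∏' (1 + d_ν s)e^{−d_ν s} ≠ 0`. [folklore] -/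
theorem tendsto_inv_expProd (hε : Tendsto ε atTop (𝓝 0)) {s : ℂ} (hs : |s.re| < ρ) :
    Tendsto (fun N => 1 / (Complex.exp (-((γ + ε N : ℝ) : ℂ) * s ^ 2) *
        ∏ ν ∈ Finset.range N, ((1 + (d ν : ℂ) * s) * Complex.exp (-((d ν : ℂ) * s)))))
      atTop (𝓝 (1 / (Complex.exp (-(γ : ℂ) * s ^ 2) *
        ∏' ν, ((1 + (d ν : ℂ) * s) * Complex.exp (-((d ν : ℂ) * s)))))) := by
  have hg : Tendsto (fun N => ((γ + ε N : ℝ) : ℂ)) atTop (𝓝 (γ : ℂ)) := by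
    have h := (tendsto_const_nhds (x := γ)).add hε
    rw [add_zero] at h
    exact (Complex.continuous_ofReal.tendsto _).comp h
  have h1 : Tendsto (fun N => Complex.exp (-((γ + ε N : ℝ) : ℂ) * s ^ 2)) atTop
      (𝓝 (Complex.exp (-(γ : ℂ) * s ^ 2))) :=
    (Complex.continuous_exp.tendsto _).comp (hg.neg.mul tendsto_const_nhds)
  have h2 := tendsto_prod_range_linExp hd s
  have hne0 : Complex.exp (-(γ : ℂ) * s ^ 2) *
      ∏' ν, ((1 + (d ν : ℂ) * s) * Complex.exp (-((d ν : ℂ) * s))) ≠ 0 :=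
    mul_ne_zero (Complex.exp_ne_zero _) (tprod_linExp_ne_zero hd hρd hs)
  exact tendsto_const_nhds.div (h1.mul h2) hne0

include hγ hd hρ hρd hne hd1 hd2 hε0 hε1 hcont hLap in
/-- **The pointwise limit**: `Λ_N(x) → 𝓕⁻(1/Ψ(2πi·))(x)` for every `x` (dominated convergence on
the Fourier side, `Λ_N = 𝓕⁻(1/Ψ_N(2πi·))` by Fourier inversion).
[cite: Schoenberg1951, §4] [folklore] -/
theorem tendsto_approx (hε : Tendsto ε atTop (𝓝 0)) (x : ℝ) :
    Tendsto (fun N => ((Λs N x : ℝ) : ℂ)) atTop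
      (𝓝 (𝓕⁻ (fun w : ℝ => 1 / (Complex.exp (-(γ : ℂ) * (2 * Real.pi * w * Complex.I) ^ 2) *
        ∏' ν, ((1 + (d ν : ℂ) * (2 * Real.pi * w * Complex.I)) *
          Complex.exp (-((d ν : ℂ) * (2 * Real.pi * w * Complex.I)))))) x)) := by
  have hc : |(0 : ℝ)| < ρ := by simpa using hρ
  set N₀ := max ν₁ ν₂ + 1 with hN₀
  have hN1 : ∀ n, ν₁ < n + N₀ := fun n => by omega
  have hN2 : ∀ n, ν₂ < n + N₀ := fun n => by omega
  set Φ : ℝ → ℂ := fun w : ℝ => 1 / (Complex.exp (-(γ : ℂ) * (2 * Real.pi * w * Complex.I) ^ 2) *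
    ∏' ν, ((1 + (d ν : ℂ) * (2 * Real.pi * w * Complex.I)) *
      Complex.exp (-((d ν : ℂ) * (2 * Real.pi * w * Complex.I))))) with hΦ
  set Φs : ℕ → ℝ → ℂ := fun N w => 1 / (Complex.exp (-((γ + ε N : ℝ) : ℂ) *
    ((0 : ℝ) + 2 * Real.pi * w * Complex.I) ^ 2) *
      ∏ ν ∈ Finset.range N, ((1 + (d ν : ℂ) * ((0 : ℝ) + 2 * Real.pi * w * Complex.I)) *
        Complex.exp (-((d ν : ℂ) * ((0 : ℝ) + 2 * Real.pi * w * Complex.I))))) with hΦs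
  set maj : ℝ → ℝ := fun w => Real.exp ((γ + 1) * ρ ^ 2) /
    ((∏' ν, (1 + d ν * (0 : ℝ)) * Real.exp (-(d ν * (0 : ℝ)))) *
      (1 + |d ν₁ / (1 + d ν₁ * (0 : ℝ)) * (d ν₂ / (1 + d ν₂ * (0 : ℝ)))| * (2 * Real.pi * w) ^ 2))
    with hmaj
  have hmaji : Integrable maj := integrable_majorant _ _ (beta_pos hρd hd1 hd2 hc)
  -- the approximants as inverse Fourier transforms
  have hrep : ∀ n, ((Λs (n + N₀) x : ℝ) : ℂ) =
      ∫ v : ℝ, Complex.exp (↑(2 * Real.pi * ⟪v, x⟫) * Complex.I) • Φs (n + N₀) v := by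
    intro n
    obtain ⟨-, -, hFeq, -, -, -, hinv⟩ :=
      tilt_package hγ hd hρd hne hd1 hd2 hε0 hε1 hcont hLap hc (hN1 n) (hN2 n)
    have hx := congrFun hinv x
    simp only [zero_mul, neg_zero, Real.exp_zero, one_mul] at hx hFeq
    rw [← hx, Real.fourierInv_eq', hFeq]
  -- dominated convergence on the Fourier side
  have hlim : Tendsto (fun n => ∫ v : ℝ, Complex.exp (↑(2 * Real.pi * ⟪v, x⟫) * Complex.I) •
      Φs (n + N₀) v) atTop
      (𝓝 (∫ v : ℝ, Complex.exp (↑(2 * Real.pi * ⟪v, x⟫) * Complex.I) • Φ v)) := by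
    refine tendsto_integral_of_dominated_convergence maj (fun n => ?_) hmaji (fun n => ?_) ?_
    · obtain ⟨-, -, hFeq, hFc, -, -, -⟩ :=
        tilt_package hγ hd hρd hne hd1 hd2 hε0 hε1 hcont hLap hc (hN1 n) (hN2 n)
      have hΦc : Continuous (Φs (n + N₀)) := by
        rw [hFeq] at hFc
        simpa [hΦs] using hFc
      exact ((by fun_prop : Continuous fun v : ℝ =>
        Complex.exp (↑(2 * Real.pi * ⟪v, x⟫) * Complex.I)).smul hΦc).aestronglyMeasurable
    · obtain ⟨-, -, hFeq, -, hFle, -, -⟩ :=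
        tilt_package hγ hd hρd hne hd1 hd2 hε0 hε1 hcont hLap hc (hN1 n) (hN2 n)
      refine Eventually.of_forall fun v => ?_
      rw [norm_smul, Complex.norm_exp_ofReal_mul_I, one_mul]
      have h := hFle v
      rw [hFeq] at h
      simpa [hΦs, hmaj] using h
    · refine Eventually.of_forall fun v => ?_
      refine Tendsto.smul tendsto_const_nhds ?_
      have hs : |((0 : ℝ) + 2 * Real.pi * v * Complex.I : ℂ).re| < ρ := by simpa using hρ
      have h := (tendsto_inv_expProd (γ := γ) hd hρd hε hs).comp (tendsto_add_atTop_nat N₀)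
      have hΦv : Φ v = 1 / (Complex.exp (-(γ : ℂ) * ((0 : ℝ) + 2 * Real.pi * v * Complex.I) ^ 2) *
          ∏' ν, ((1 + (d ν : ℂ) * ((0 : ℝ) + 2 * Real.pi * v * Complex.I)) *
            Complex.exp (-((d ν : ℂ) * ((0 : ℝ) + 2 * Real.pi * v * Complex.I))))) := by
        simp [hΦ]
      rw [hΦv]
      exact h
  rw [← tendsto_add_atTop_iff_nat N₀]
  simp only [hrep]
  rw [Real.fourierInv_eq']
  exact hlim

include hγ hd hρ hρd hne hd1 hd2 hε0 hε1 hPF hcont hLap in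
/-- **The abstract limit theorem** (Schoenberg 1951, Thm. 1, sufficiency, general case): under
the standing hypotheses (continuous Pólya frequency functions `Λ_N` with reciprocal transforms
`e^{−(γ+ε_N)s²} ∏_{ν<N} (1 + d_ν s)e^{−d_ν s}` on `|Re s| < ρ`, `ε_N → 0`), the pointwise limit
`Λ = lim Λ_N` exists and is a Pólya frequency function whose bilateral Laplace transform converges
absolutely on `|Re s| < ρ` to `1/(e^{−γs²} ∏' (1 + d_ν s)e^{−d_ν s})`.
[cite: Schoenberg1951, Thm. 1 (sufficiency), §4]
[cite: SchoenbergWhitney1953, Introduction pp. 246–247, (6)–(7)] -/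
theorem exists_pf_of_approx (hε : Tendsto ε atTop (𝓝 0)) :
    ∃ Λ : ℝ → ℝ, IsPolyaFrequencyFun Λ ∧
      HasLaplaceTransformInvOn Λ (fun s => Complex.exp (-(γ : ℂ) * s ^ 2) *
        ∏' ν, ((1 + (d ν : ℂ) * s) * Complex.exp (-((d ν : ℂ) * s)))) (-ρ) ρ := by
  -- the limit function
  set L : ℝ → ℂ := 𝓕⁻ (fun w : ℝ => 1 / (Complex.exp (-(γ : ℂ) * (2 * Real.pi * w * Complex.I) ^ 2) *
    ∏' ν, ((1 + (d ν : ℂ) * (2 * Real.pi * w * Complex.I)) *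
      Complex.exp (-((d ν : ℂ) * (2 * Real.pi * w * Complex.I)))))) with hL
  set Λ : ℝ → ℝ := fun x => (L x).re with hΛdef
  have hLx : ∀ x, Tendsto (fun N => ((Λs N x : ℝ) : ℂ)) atTop (𝓝 (L x)) := fun x =>
    tendsto_approx hγ hd hρ hρd hne hd1 hd2 hε0 hε1 hcont hLap hε x
  have hLim : ∀ x, (L x).im = 0 := fun x => by
    have h1 : Tendsto (fun N => (((Λs N x : ℝ) : ℂ)).im) atTop (𝓝 ((L x).im)) :=
      (Complex.continuous_im.tendsto _).comp (hLx x)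
    simp only [Complex.ofReal_im] at h1
    exact tendsto_nhds_unique h1 tendsto_const_nhds
  have hLeq : ∀ x, ((Λ x : ℝ) : ℂ) = L x := fun x => by
    apply Complex.ext
    · simp [hΛdef]
    · simp [hLim x]
  have hΛx : ∀ x, Tendsto (fun N => Λs N x) atTop (𝓝 (Λ x)) := fun x => by
    have h1 := (Complex.continuous_re.tendsto _).comp (hLx x)
    have h2 : (Complex.re ∘ fun N => ((Λs N x : ℝ) : ℂ)) = fun N => Λs N x := by
      funext N
      simp
    rw [h2] at h1
    simpa [hΛdef] using h1
  -- non-negativity, measurability, minors pass to the limit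
  have hnonneg : ∀ x, 0 ≤ Λ x := fun x => ge_of_tendsto' (hΛx x) fun N => (hPF N).nonneg x
  have hmeas : Measurable Λ :=
    measurable_of_tendsto_metrizable (fun N => (hcont N).measurable) (tendsto_pi_nhds.2 hΛx)
  have hminor : ∀ (n : ℕ) (x y : Fin n → ℝ), StrictMono x → StrictMono y →
      0 ≤ translationMinor Λ x y := by
    intro n x y hx hy
    have ht : Tendsto (fun N => translationMinor (Λs N) x y) atTop
        (𝓝 (translationMinor Λ x y)) := by
      unfold translationMinor
      have hmat : Tendsto (fun N => Matrix.of fun i j : Fin n => Λs N (x i - y j)) atTop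
          (𝓝 (Matrix.of fun i j : Fin n => Λ (x i - y j))) :=
        tendsto_pi_nhds.2 fun i => tendsto_pi_nhds.2 fun j => hΛx _
      exact ((continuous_id.matrix_det).tendsto _).comp hmat
    exact ge_of_tendsto' ht fun N => (hPF N).2.2.2.2 n x y hx hy
  -- the transform, by dominated convergence with two-sided exponential bounds
  have htrans : HasLaplaceTransformInvOn Λ (fun s => Complex.exp (-(γ : ℂ) * s ^ 2) *
      ∏' ν, ((1 + (d ν : ℂ) * s) * Complex.exp (-((d ν : ℂ) * s)))) (-ρ) ρ := by
    intro s hs1 hs2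
    set c := s.re with hc_def
    have hc : |c| < ρ := abs_lt.2 ⟨hs1, hs2⟩
    set c₁ := (c - ρ) / 2 with hc₁
    set c₂ := (c + ρ) / 2 with hc₂
    have hc₁ρ : |c₁| < ρ := by
      rw [abs_lt, hc₁]
      constructor <;> linarith
    have hc₂ρ : |c₂| < ρ := by
      rw [abs_lt, hc₂]
      constructor <;> linarith
    obtain ⟨S₁, hS₁⟩ := tilt_le hγ hd hρd hne hd1 hd2 hε0 hε1 hPF hcont hLap hc₁ρ
    obtain ⟨S₂, hS₂⟩ := tilt_le hγ hd hρd hne hd1 hd2 hε0 hε1 hPF hcont hLap hc₂ρ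
    set N₀ := max ν₁ ν₂ + 1 with hN₀
    have hN1 : ∀ n, ν₁ < n + N₀ := fun n => by omega
    have hN2 : ∀ n, ν₂ < n + N₀ := fun n => by omega
    set k₁ := c - c₁ with hk₁def
    set k₂ := c₂ - c with hk₂def
    have hk₁ : 0 < k₁ := by
      rw [hk₁def, hc₁]
      linarith
    have hk₂ : 0 < k₂ := by
      rw [hk₂def, hc₂]
      linarith
    set bound : ℝ → ℝ := fun x => (Set.Ici (0 : ℝ)).indicator (fun x => S₁ * Real.exp (-(k₁ * x))) x +
      (Set.Iio (0 : ℝ)).indicator (fun x => S₂ * Real.exp (k₂ * x)) x with hbound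
    have hbi : Integrable bound := by
      refine Integrable.add ?_ ?_
      · rw [integrable_indicator_iff measurableSet_Ici, integrableOn_Ici_iff_integrableOn_Ioi]
        have h := (exp_neg_integrableOn_Ioi 0 hk₁).const_mul S₁
        refine IntegrableOn.congr_fun h (fun x _ => ?_) measurableSet_Ioi
        simp only [neg_mul]
      · rw [integrable_indicator_iff measurableSet_Iio]
        exact ((integrableOn_exp_mul_Iic hk₂ 0).mono_set Set.Iio_subset_Iic_self).const_mul S₂
    set F : ℕ → ℝ → ℂ := fun n x => Complex.exp (-(x : ℂ) * s) * ((Λs (n + N₀) x : ℝ) : ℂ)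
      with hF
    have hFmeas : ∀ n, AEStronglyMeasurable (F n) volume := fun n => by
      have hcn := hcont (n + N₀)
      exact (Continuous.aestronglyMeasurable (by rw [hF]; fun_prop))
    have hre : ∀ x : ℝ, (-(x : ℂ) * s).re = -(c * x) := fun x => by
      simp [hc_def]
      ring
    have hFbound : ∀ n x, ‖F n x‖ ≤ bound x := by
      intro n x
      rw [hF]
      simp only
      rw [norm_mul, Complex.norm_exp, Complex.norm_real, Real.norm_eq_abs,
        abs_of_nonneg ((hPF _).nonneg x), hre]
      by_cases hx : 0 ≤ x
      · have h := hS₁ (n + N₀) (hN1 n) (hN2 n) x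
        have hnot : x ∉ Set.Iio (0 : ℝ) := by simpa using hx
        rw [hbound]
        simp only [Set.indicator_of_mem (Set.mem_Ici.2 hx), Set.indicator_of_notMem hnot,
          add_zero]
        calc Real.exp (-(c * x)) * Λs (n + N₀) x
            = Real.exp (-(k₁ * x)) * (Real.exp (-(c₁ * x)) * Λs (n + N₀) x) := by
              rw [← mul_assoc, ← Real.exp_add]
              congr 1
              rw [hk₁def]
              ring
          _ ≤ Real.exp (-(k₁ * x)) * S₁ := mul_le_mul_of_nonneg_left h (Real.exp_pos _).le
          _ = S₁ * Real.exp (-(k₁ * x)) := mul_comm _ _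
      · have hx' : x < 0 := lt_of_not_ge hx
        have h := hS₂ (n + N₀) (hN1 n) (hN2 n) x
        have hnot : x ∉ Set.Ici (0 : ℝ) := by simpa using hx'
        rw [hbound]
        simp only [Set.indicator_of_notMem hnot, Set.indicator_of_mem (Set.mem_Iio.2 hx'),
          zero_add]
        calc Real.exp (-(c * x)) * Λs (n + N₀) x
            = Real.exp (k₂ * x) * (Real.exp (-(c₂ * x)) * Λs (n + N₀) x) := by
              rw [← mul_assoc, ← Real.exp_add]
              congr 1
              rw [hk₂def]
              ring
          _ ≤ Real.exp (k₂ * x) * S₂ := mul_le_mul_of_nonneg_left h (Real.exp_pos _).le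
          _ = S₂ * Real.exp (k₂ * x) := mul_comm _ _
    have hFlim : ∀ x, Tendsto (fun n => F n x) atTop
        (𝓝 (Complex.exp (-(x : ℂ) * s) * ((Λ x : ℝ) : ℂ))) := fun x => by
      rw [hLeq x]
      exact tendsto_const_nhds.mul ((hLx x).comp (tendsto_add_atTop_nat N₀))
    have hDCT := tendsto_integral_of_dominated_convergence bound hFmeas hbi
      (fun n => Eventually.of_forall (hFbound n)) (Eventually.of_forall hFlim)
    -- the values of the approximating transforms
    have hvals : ∀ n, ∫ x, F n x = 1 / (Complex.exp (-((γ + ε (n + N₀) : ℝ) : ℂ) * s ^ 2) *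
        ∏ ν ∈ Finset.range (n + N₀), ((1 + (d ν : ℂ) * s) * Complex.exp (-((d ν : ℂ) * s)))) :=
      fun n => (hLap (n + N₀) s hs1 hs2).2.2
    have hsre : |s.re| < ρ := hc
    have hΨlim := (tendsto_inv_expProd (γ := γ) hd hρd hε hsre).comp (tendsto_add_atTop_nat N₀)
    have hDCT' : Tendsto (fun n => 1 / (Complex.exp (-((γ + ε (n + N₀) : ℝ) : ℂ) * s ^ 2) *
        ∏ ν ∈ Finset.range (n + N₀), ((1 + (d ν : ℂ) * s) * Complex.exp (-((d ν : ℂ) * s)))))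
        atTop (𝓝 (∫ x : ℝ, Complex.exp (-(x : ℂ) * s) * ((Λ x : ℝ) : ℂ))) :=
      hDCT.congr hvals
    have heq := tendsto_nhds_unique hDCT' hΨlim
    refine ⟨?_, mul_ne_zero (Complex.exp_ne_zero _) (tprod_linExp_ne_zero hd hρd hsre), heq⟩
    -- integrability of the limit integrand
    have hmeasC : AEStronglyMeasurable (fun x : ℝ => Complex.exp (-(x : ℂ) * s) * ((Λ x : ℝ) : ℂ))
        volume :=
      ((by fun_prop : Continuous fun x : ℝ => Complex.exp (-(x : ℂ) * s)).aestronglyMeasurable).mul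
        (Complex.measurable_ofReal.comp hmeas).aestronglyMeasurable
    refine hbi.mono' hmeasC (Eventually.of_forall fun x => ?_)
    exact le_of_tendsto ((continuous_norm.tendsto _).comp (hFlim x))
      (Eventually.of_forall fun n => hFbound n x)
  -- integrability and total mass from the transform at `s = 0`
  obtain ⟨hint0, -, hval0⟩ := htrans 0 (by simpa using hρ) (by simpa using hρ)
  have h2 : (fun x : ℝ => Complex.exp (-(x : ℂ) * 0) * ((Λ x : ℝ) : ℂ)) =
      fun x : ℝ => ((Λ x : ℝ) : ℂ) := by
    funext x
    simp
  rw [h2] at hint0 hval0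
  have hintΛ : Integrable Λ := by
    have h := hint0.re
    simpa using h
  have hval0' : ∫ x : ℝ, ((Λ x : ℝ) : ℂ) = 1 := by
    rw [hval0]
    simp [sq]
  have hval : ∫ x, Λ x = 1 := by
    rw [integral_complex_ofReal] at hval0'
    exact_mod_cast hval0'
  exact ⟨Λ, ⟨hnonneg, hmeas, hintΛ, by rw [hval]; exact one_pos, hminor⟩, htrans⟩

end Approx

end Literature.Analysis.TotalPositivity

end
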